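import Literature.NumberTheory.EllipticCurves.Rubin1991.TwoVariableMainConjecture
import Literature.NumberTheory.EllipticCurves.Rubin1991.TwoVariableCMLines
import HarnessLib

/-!
# Crux `PrintCf2.SplitBadTwoRankOneOfFacts` (stmt-BirchSwinnertonDyer-20368), road α v10 — brick B14 (clause (f) of the v10 supply stub
# `stub_frameSupply_two_v10`): VALUES OF A TWO-VARIABLE INTEGRAL SERIES EXIST ON THE OPEN BIDISC

Cell `bsd-print-cf2`, LEAD seat `bsd-line-cf2-p1` g11 (prover-bsd-line-cf2-p1-g11-0); `--supports stmt-BirchSwinnertonDyer-20368` (helper,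
Theses-free). HONEST FRAMING: nothing here closes the crux or a registered stub; BSD is not proved by any of this; no summit statement is
proved by this seat. No definition, no named fact, no `sorry`.

The v10 (two-variable-native) frame of road α (`Cruxes/SplitBadTwoRankOneOfFacts/Lines/rubin_value_two_lead_v10.lean`, LEAD g11, candidate)
reads the Rubin value as `val` with `IntSeries.HasValueAt₂ G₂ (r(γ₁⁻¹) − 1) (r(γ₂⁻¹) − 1) val` for S3a's measure `G₂ ∈ 𝒪_{ℂ₂}⟦T₁⟧⟦T₂⟧`
(`Literature/…/Rubin1991/TwoVariableMainConjecture`: `HasValueAt₂` = `HasSum` over `ℕ × ℕ`; the tree has `unique`, `sub`, `const_mul`, `zero`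
for it, but no EXISTENCE). This file is the two-variable twin of the tree's one-variable `IntSeries.exists_hasValueAt`
(`BurungaleKobayashiNakamuraOta2026/RubinPadicLFunctionValuesProofs`): for `‖x‖, ‖y‖ < 1` the double series `∑ [T₁^i T₂^j]G · x^i y^j`
is dominated by the summable `‖x‖^i ‖y‖^j`, hence converges (absolutely) in the complete field `ℂ_p`, and its value is integral for
`‖x‖, ‖y‖ ≤ 1`:
* `norm_term₂_le`, `summable₂_of_norm_lt_one`, **`exists_hasValueAt₂_of_norm_lt_one`**, `norm_le_one_of_hasValueAt₂`.
So clause (f) of `stub_frameSupply_two_v10` holds at every point of the open bidisc; the supply prover only owes `‖r(γᵢ⁻¹) − 1‖ < 1`.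
presearch: Washington, *Cyclotomic Fields* §7.2 (convergence of `𝒪`-power series on the open disc); de Shalit 1987 II.4.17 (54) — held;
nothing new filed.

References: [Washington1997] §7.2; [deShalit1987] II.4.17 (54).
-/

noncomputable section

open scoped Classical

set_option linter.dupNamespace false
set_option autoImplicit false

open Literature.NumberTheory.EllipticCurves

namespace Summit.BirchSwinnertonDyer.BirchSwinnertonDyer.Theorems.PrintCf2.KatzMeasureValue

variable {p : ℕ} [Fact p.Prime] (G : PowerSeries (PowerSeries (PadicComplexInt p)))

/-- The terms `[T₁^i T₂^j]G · x^i y^j` are dominated by `‖x‖^i ‖y‖^j` (coefficients in `𝒪_{ℂ_p}`). [cite: Washington1997, §7.2] -/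
theorem norm_term₂_le (x y : ℂ_[p]) (k : ℕ × ℕ) :
    ‖((PowerSeries.coeff k.2 (PowerSeries.coeff k.1 G) : PadicComplexInt p) : ℂ_[p]) * x ^ k.1 * y ^ k.2‖ ≤
      ‖x‖ ^ k.1 * ‖y‖ ^ k.2 := by
  rw [norm_mul, norm_mul, norm_pow, norm_pow]
  have h1 : ‖((PowerSeries.coeff k.2 (PowerSeries.coeff k.1 G) : PadicComplexInt p) : ℂ_[p])‖ ≤ 1 :=
    norm_coe_padicComplexInt_le_one _
  have hx : 0 ≤ ‖x‖ ^ k.1 := pow_nonneg (norm_nonneg _) _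
  have hy : 0 ≤ ‖y‖ ^ k.2 := pow_nonneg (norm_nonneg _) _
  calc _ ≤ 1 * ‖x‖ ^ k.1 * ‖y‖ ^ k.2 := by gcongr
    _ = ‖x‖ ^ k.1 * ‖y‖ ^ k.2 := by rw [one_mul]

/-- **On the open bidisc the double value series converges (absolutely).** [cite: Washington1997, §7.2]
[cite: deShalit1987, II.4.17 (54)] -/
theorem summable₂_of_norm_lt_one {x y : ℂ_[p]} (hx : ‖x‖ < 1) (hy : ‖y‖ < 1) :
    Summable fun k : ℕ × ℕ ↦
      ((PowerSeries.coeff k.2 (PowerSeries.coeff k.1 G) : PadicComplexInt p) : ℂ_[p]) * x ^ k.1 * y ^ k.2 := by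
  have hg : Summable fun k : ℕ × ℕ ↦ ‖x‖ ^ k.1 * ‖y‖ ^ k.2 :=
    (summable_geometric_of_lt_one (norm_nonneg x) hx).mul_of_nonneg
      (summable_geometric_of_lt_one (norm_nonneg y) hy)
      (fun _ ↦ pow_nonneg (norm_nonneg _) _) (fun _ ↦ pow_nonneg (norm_nonneg _) _)
  exact hg.of_norm_bounded (norm_term₂_le G x y)

/-- **VALUES EXIST ON THE OPEN BIDISC**: for `‖x‖, ‖y‖ < 1` there is `v` with `IntSeries.HasValueAt₂ G x y v` — so clause (f) of the
v10 supply stub `stub_frameSupply_two_v10` (and the `∀ val, HasValueAt₂ … → …` read-outs of S2′-v10 / S3b′-v10) are never vacuous at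
the points `(r(γ₁⁻¹) − 1, r(γ₂⁻¹) − 1)` of a character `r` with values in `1 + 𝔪`. [cite: deShalit1987, II.4.17 (54)]
[cite: Washington1997, §7.2] -/
theorem exists_hasValueAt₂_of_norm_lt_one {x y : ℂ_[p]} (hx : ‖x‖ < 1) (hy : ‖y‖ < 1) :
    ∃ v : ℂ_[p], IntSeries.HasValueAt₂ G x y v :=
  ⟨_, (summable₂_of_norm_lt_one G hx hy).hasSum⟩

variable {G}

/-- **Integrality of values**: `‖G(x, y)‖ ≤ 1` for `‖x‖, ‖y‖ ≤ 1` whenever the value exists (ultrametric bound on a `tsum`).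
[cite: Washington1997, §7.2] -/
theorem norm_le_one_of_hasValueAt₂ {x y v : ℂ_[p]} (h : IntSeries.HasValueAt₂ G x y v) (hx : ‖x‖ ≤ 1) (hy : ‖y‖ ≤ 1) :
    ‖v‖ ≤ 1 := by
  rw [← h.tsum_eq]
  exact IsUltrametricDist.norm_tsum_le_of_forall_le_of_nonneg zero_le_one fun k ↦
    (norm_term₂_le G x y k).trans
      (mul_le_one₀ (pow_le_one₀ (norm_nonneg _) hx) (pow_nonneg (norm_nonneg _) _) (pow_le_one₀ (norm_nonneg _) hy))

/-- The value at a point of the CLOSED bidisc with one coordinate in the open disc… (not needed); instead: **the value depends only on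
the point** — restatement of the tree's uniqueness for consumers of this file. [cite: deShalit1987, II.4.17 (54)] -/
theorem hasValueAt₂_unique {x y v v' : ℂ_[p]} (h : IntSeries.HasValueAt₂ G x y v) (h' : IntSeries.HasValueAt₂ G x y v') :
    v = v' :=
  h.unique h'

end Summit.BirchSwinnertonDyer.BirchSwinnertonDyer.Theorems.PrintCf2.KatzMeasureValue

end
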